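import Summits.BirchSwinnertonDyer.BirchSwinnertonDyer.Theorems.EisensteinDepletionAtTwoStarEisFiniteLevel
import Summits.BirchSwinnertonDyer.BirchSwinnertonDyer.Theorems.EisensteinDepletionAtTwoStarEisEight
import Summits.BirchSwinnertonDyer.BirchSwinnertonDyer.Theorems.EisensteinDepletionAtTwoStarKlTwoWitness
import Summits.BirchSwinnertonDyer.BirchSwinnertonDyer.Theorems.EisensteinDepletionAtTwoStarGlueFinScaleLemmas
import Summits.BirchSwinnertonDyer.BirchSwinnertonDyer.Theorems.EisensteinDepletionAtTwoStarEulerOrder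
import HarnessLib

/-!
# Route `EisensteinDepletionAtTwo`, crux E1M `DepletedLambdaLawAtTwoMod` (item stmt-BirchSwinnertonDyer-20341),
# line `star` — the 2-content of the Eisenstein cusp differences on `C` is EXACTLY `2³` (an odd witness exists)

Cell `bsd-rank2` (HOME run/shared/lean/pub/bsd-rank2/), seat `bsd-rank2-star-p1` GEN 2 (lead of line `star`). THEOREMS ONLY — no
definition, no named fact, no `sorry`. HONEST FRAMING: a `2`-adic bookkeeping COROLLARY of two tree theorems of eng-2 g8 — the smoothed
finite-level Eisenstein congruence `starEisFin` (`…StarEisFiniteLevel`, p560388) and the mod-8 rigidity bound `starEisEight₂`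
(`…StarEisEight`, p564958) — closing the residual (R3) «μ = 0 / oddness of the Eisenstein winding numbers on C» of planner p2 GEN 21's
reduction of the research stub `stub_starSymbC` (memo p2/g21/serre-dlog.md §§9, 13; DONE line 18:56:39Z): the PRIMITIVE scale of
`v = stabEisCuspDiff N β` on `C` is exactly `8` up to a `2`-adic unit. Nothing here reads an analytic rank; (★-SymbC)/(★)/E1M are NOT
proved; BSD is not proved by any of this (PARTITION D-0054: none — r_an ≥ 2 axis S0, door T-r3₂).

* `exists_inC_norm_stabEisCuspDiff_eq` — for odd `N` and admissible `β` there is `(m, a) ∈ C` with `‖v(m,a)‖₂ = 8⁻¹` (numerically the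
  2-content of `v` on `C` is exactly `2³` on every admissible datum: eng-2 g8 evidence #39 (b), lit GEN 21 18:09Z (F4)/(F5)).
  PROOF: `‖v‖₂ ≤ 8⁻¹` on `C` (`starEisEight₂`); if `‖v‖₂ < 8⁻¹` everywhere on `C` then (discreteness) `‖v‖₂ ≤ 16⁻¹`, so the scale-`8`
  `C`-normalised measure `ν₈ = eisNormMeasure N β 8` is `≡ 0 (mod 2)` pointwise, hence so are its Stevens smoothing and all its Riemann sums
  (`norm_stevensSmoothing_le_of_forall_le`, `norm_distributionRiemannSum_le`); by `starEisFin` every coefficient of `H` is then `≡ 0 (mod 2)`,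
  i.e. `red H = 0` — contradicting `red H = red((1+T)^e)·red(pfree G₀)·red(pfree G₀^ι)·∏ red(γ_ℓ−1)^{ord_ℓ N} ≠ 0` (Kubota–Leopoldt witnesses
  from `star_klTwoWitness`, `red_frobeniusSeries_sub_one_ne_zero_two`).

References: G. Stevens, *Arithmetic on Modular Curves* (1982), §5.4 [Stevens1982]; B. Mazur, J. Tate, J. Teitelbaum, Invent. Math. 84 (1986),
§I.10–I.13 [MazurTateTeitelbaum1986Invent]; L. Washington, GTM 83, §7.1 [Washington1997].
-/

set_option linter.dupNamespace false
set_option autoImplicit false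

noncomputable section

open scoped Classical

open Filter Topology
  Literature.NumberTheory.EllipticCurves Literature.NumberTheory.EllipticCurves.GreenbergVatsal2000
  Summit.BirchSwinnertonDyer.Rank1Residual.X1.MuLambda

namespace Summit.BirchSwinnertonDyer.BirchSwinnertonDyer.Theorems.DepletionAtTwo

section OddWitness

variable {N : ℕ} {β : ℕ → ℕ}

/-- **The 2-content of the Eisenstein cusp differences on `C` is exactly `2³`.** For odd `N` and admissible `β` there is
`(m, a) ∈ C` with `‖stabEisCuspDiff N β m a‖₂ = 8⁻¹` (the residual (R3) «oddness of the Eisenstein winding numbers on `C`» of the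
reduction of (★-SymbC); everywhere `≤ 8⁻¹` by `starEisEight₂`, and `< 8⁻¹` everywhere would make every Riemann sum of the smoothed
scale-`8` measure even, forcing `red H = 0` in `starEisFin`). [cite: Stevens1982, §5.4 (PDF pp. 73–74)]
[cite: MazurTateTeitelbaum1986Invent, §I.10–I.13] [cite: Washington1997, §7.1] -/
theorem exists_inC_norm_stabEisCuspDiff_eq (hodd : Odd N) (hadm : IsAdmissibleStabData N β) :
    ∃ (m : ℕ) (a : ℤ), InC m a ∧ ‖((stabEisCuspDiff N β m a : ℚ) : ℚ_[2])‖ = 8⁻¹ := by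
  by_contra hne
  push Not at hne
  -- everywhere on `C`: `‖v‖ ≤ 16⁻¹`
  have h16 : ∀ (m : ℕ) (a : ℤ), InC m a → ‖((stabEisCuspDiff N β m a : ℚ) : ℚ_[2])‖ ≤ 16⁻¹ := by
    intro m a h
    have hle := starEisEight₂ N hodd β hadm m a h
    have hlt : ‖((stabEisCuspDiff N β m a : ℚ) : ℚ_[2])‖ < 8⁻¹ := lt_of_le_of_ne hle (hne m a h)
    have hlt' : ‖((stabEisCuspDiff N β m a : ℚ) : ℚ_[2])‖ < ((2 : ℕ) : ℝ) ^ (-3 : ℤ) := by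
      rw [show ((2 : ℕ) : ℝ) ^ (-3 : ℤ) = 8⁻¹ by norm_num]; exact hlt
    have := (Padic.norm_lt_pow_iff_norm_le_pow_sub_one _ (-3)).mp hlt'
    rw [show ((2 : ℕ) : ℝ) ^ ((-3 : ℤ) - 1) = 16⁻¹ by norm_num] at this
    exact this
  -- `v/8` on the classes of level `n + 2` relevant to `ν₈`, including the class of `1`
  have h16' : ∀ (m b : ℕ), 3 ≤ m → b % 4 = 1 → b < 2 ^ m →
      ‖((stabEisCuspDiff N β m (b : ℤ) : ℚ) : ℚ_[2])‖ ≤ 16⁻¹ := by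
    intro m b hm hb4 hb
    by_cases h1 : b = 1
    · subst h1; rw [Nat.cast_one, stabEisCuspDiff_one, Rat.cast_zero, norm_zero]; norm_num
    · exact h16 m b ⟨hm, by omega, by omega, by exact_mod_cast hb⟩
  -- hence `ν₈ ≡ 0 (mod 2)` pointwise at every level `n + 2`, `n ≥ 2`
  have hν : ∀ {n : ℕ}, 2 ≤ n → ∀ a : ZMod (2 ^ (n + 2)), ‖eisNormMeasure N β 8 (n + 2) a‖ ≤ 2⁻¹ := by
    intro n hn a
    by_cases ha : a.val % 4 = 1
    · have hAlt : a.val < 2 ^ (n + 2) := ZMod.val_lt a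
      have h4 : 4 ∣ 2 ^ (n + 1) := by
        have := pow_dvd_pow 2 (show 2 ≤ n + 1 by omega); simpa using this
      have habar4 : (a.val % 2 ^ (n + 1)) % 4 = 1 := by rw [Nat.mod_mod_of_dvd _ h4]; exact ha
      have habarlt : a.val % 2 ^ (n + 1) < 2 ^ (n + 1) := Nat.mod_lt _ (pow_pos two_pos _)
      have hA := h16' (n + 2) a.val (by omega) ha hAlt
      have hAbar := h16' (n + 1) (a.val % 2 ^ (n + 1)) (by omega) habar4 habarlt
      rw [eisNormMeasure_of N β 8 ⟨by omega, ha⟩, show n + 2 - 1 = n + 1 by omega, Rat.cast_div, Rat.cast_sub,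
        Rat.cast_ofNat, norm_div]
      have h8n : ‖(8 : ℚ_[2])‖ = 8⁻¹ := by
        rw [show (8 : ℚ_[2]) = ((2 : ℕ) : ℚ_[2]) ^ 3 by norm_num, norm_pow, Padic.norm_p]; norm_num
      rw [h8n]
      have hsub : ‖((stabEisCuspDiff N β (n + 2) (a.val : ℤ) : ℚ) : ℚ_[2]) -
          ((stabEisCuspDiff N β (n + 1) ((a.val % 2 ^ (n + 1) : ℕ) : ℤ) : ℚ) : ℚ_[2])‖ ≤ 16⁻¹ :=
        norm_sub_le_of_le_two hA hAbar
      calc _ ≤ (16⁻¹ : ℝ) / 8⁻¹ := by gcongr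
        _ = 2⁻¹ := by norm_num
    · rw [eisNormMeasure_of_not N β 8 (fun h ↦ ha h.2), norm_zero]; norm_num
  -- the Kubota–Leopoldt witnesses and the finite-level Eisenstein congruence
  obtain ⟨⟨cg, G₀, hG₀, hιG, -⟩, ⟨ci, GI₀, hGI₀, hιGI, -⟩⟩ := star_klTwoWitness
  obtain ⟨H, e, hH, hredH⟩ := starEisFin N hodd β hadm cg G₀ hG₀ hιG ci GI₀ hGI₀ hιGI
  have h2N : ∀ ℓ ∈ N.primeFactors, ℓ ≠ 2 := fun ℓ hℓ h2 ↦
    (Nat.not_even_iff_odd.mpr hodd) (even_iff_two_dvd.mpr (h2 ▸ Nat.dvd_of_mem_primeFactors hℓ))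
  -- `red H ≠ 0`
  have hredne : red H ≠ 0 := by
    rw [hredH]
    refine mul_ne_zero (mul_ne_zero (mul_ne_zero ?_ (red_pfree_ne_zero hG₀)) (red_pfree_ne_zero hGI₀))
      (Finset.prod_ne_zero_iff.mpr fun ℓ hℓ ↦ pow_ne_zero _ ?_)
    · intro h
      have h0 := congrArg (PowerSeries.coeff 0) h
      unfold red at h0
      rw [PowerSeries.coeff_map, PowerSeries.binomialSeries_coeff, Ring.choose_zero_right, one_smul, map_one,
        map_zero] at h0
      exact one_ne_zero h0
    · exact red_frobeniusSeries_sub_one_ne_zero_two (Nat.prime_of_mem_primeFactors hℓ) (h2N ℓ hℓ)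
  -- but every coefficient of `H` is `≡ 0 (mod 2)`
  apply hredne
  have hzero : red H = red 0 := by
    refine red_eq_red_of_norm_coeff_sub_lt_one fun k ↦ ?_
    obtain ⟨n, hn, hn2⟩ := ((hH k).and (eventually_ge_atTop 2)).exists
    have hRS : ‖distributionRiemannSum (stevensSmoothing 5 (eisNormMeasure N β 8)) k n‖ ≤ 2⁻¹ :=
      norm_distributionRiemannSum_le _ (by norm_num)
        (fun a ↦ norm_stevensSmoothing_le_of_forall_le (eisNormMeasure N β 8) (hν hn2) a) k
    have hco : ‖PowerSeries.coeff k (iwasawaToPowerSeries 2 H)‖ ≤ 2⁻¹ := by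
      have : PowerSeries.coeff k (iwasawaToPowerSeries 2 H) =
          distributionRiemannSum (stevensSmoothing 5 (eisNormMeasure N β 8)) k n -
            (distributionRiemannSum (stevensSmoothing 5 (eisNormMeasure N β 8)) k n -
              PowerSeries.coeff k (iwasawaToPowerSeries 2 H)) := by ring
      rw [this]
      exact norm_sub_le_of_le_two hRS hn
    rw [PowerSeries.coeff_map] at hco
    change ‖((PowerSeries.coeff k H : ℤ_[2]) : ℚ_[2])‖ ≤ 2⁻¹ at hco
    rw [PadicInt.padic_norm_e_of_padicInt] at hco
    rw [map_zero, sub_zero]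
    exact hco.trans_lt (by norm_num)
  rw [hzero]
  exact map_zero _

/-- **Corollary: the primitive scale on the Eisenstein side is exactly `8`.** For odd `N`, admissible `β` and any `g' ∈ ℚ` such that
`v(m,a)/g'` is an INTEGER for every `(m,a) ∈ C` and odd for some `(m,a) ∈ C` (a primitive scale of `v` on `C`, as in (★-SymbC)),
`‖g'‖₂ = 8⁻¹`. [cite: Washington1997, §7.1] -/
theorem norm_eq_eighth_of_primitiveScale (hodd : Odd N) (hadm : IsAdmissibleStabData N β) {g' : ℚ}
    (hint : ∀ (m : ℕ) (a : ℤ), InC m a → ∃ n : ℤ, stabEisCuspDiff N β m a = n * g')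
    (hprim : ∃ (m : ℕ) (a : ℤ), InC m a ∧ ∃ n : ℤ, stabEisCuspDiff N β m a = n * g' ∧ Odd n) :
    ‖((g' : ℚ) : ℚ_[2])‖ = 8⁻¹ := by
  refine le_antisymm ?_ ?_
  · -- at the odd point: `‖g'‖ = ‖v‖ ≤ 8⁻¹`
    obtain ⟨m, a, hma, n, hv, hn⟩ := hprim
    have h8 := starEisEight₂ N hodd β hadm m a hma
    rw [hv, Rat.cast_mul, Rat.cast_intCast, norm_mul, norm_intCast_eq_one_of_odd hn, one_mul] at h8
    exact h8
  · -- at the witness of `‖v‖ = 8⁻¹`: `8⁻¹ = ‖n‖·‖g'‖ ≤ ‖g'‖`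
    obtain ⟨m, a, hma, hv8⟩ := exists_inC_norm_stabEisCuspDiff_eq hodd hadm
    obtain ⟨n, hv⟩ := hint m a hma
    rw [hv, Rat.cast_mul, Rat.cast_intCast, norm_mul] at hv8
    calc (8⁻¹ : ℝ) = ‖(n : ℚ_[2])‖ * ‖((g' : ℚ) : ℚ_[2])‖ := hv8.symm
      _ ≤ 1 * ‖((g' : ℚ) : ℚ_[2])‖ := by gcongr; exact Padic.norm_int_le_one n
      _ = _ := one_mul _

end OddWitness

end Summit.BirchSwinnertonDyer.BirchSwinnertonDyer.Theorems.DepletionAtTwo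

end
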